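import Literature.NumberTheory.GaloisRepresentations.CyclicLayerCarry
import Literature.NumberTheory.GaloisRepresentations.CohomologicalDimensionTowerProofs
import Literature.NumberTheory.GaloisRepresentations.RestrictionCalculus
import HarnessLib

/-!
# `H²` of a cyclic layer, II: every class killed by `res_T` is a `κ(a)` (Serre, *Corps locaux* VII §6, VIII §4)

Sequel to `CyclicLayerCarry.lean`.  For a profinite group `G`, a cyclic layer `χ : G → ℤ/d` with
kernel `T`, and a discrete `G`-module `A` with `H¹(T, A) = 0`, this file proves the remaining
half of the description of `ker(res : H²(G, A) → H²(T, A))`: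

* `exists_cyclicClass_eq_of_res_eq_zero` — **every `z ∈ H²(G, A)` with `res_T z = 0` is `κ(a)`
  for some `a ∈ A^G`**.

Classically this is inflation–restriction in degree `2` (Serre, *Corps locaux*, VII §6 Prop. 5:
`0 → H²(G/T, A^T) → H²(G, A) → H²(T, A)`) combined with the computation of `H²` of the finite
cyclic group `G/T` (VIII §4).  The proof here runs the dimension shift `0 → A → C(G, A) → Q → 0` of
the tree (`isSES_coind`, acyclicity of `C(G, A)` for `G` and for `T`) with the connecting maps of
`ContinuousCohomologyConnecting.lean`: `z = δ₁[ψ]` with `res_T [ψ] = 0` (naturality of `δ₁` under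
restriction, `IsSES.res_δ₁`), so after normalising `ψ|_T = 0` the crossed homomorphism `ψ` is
`ψ(sⁱ t) = Σ_{k<i} s^k w` with `w = ψ(s) ∈ Q^T`, `N_s w = 0`; lifting `w` to `ĩ ∈ C(G, A)^T`
(`H¹(T, A) = 0`) and `ψ` to `σ ↦ Σ_{k<χ̃σ} s^k ĩ`, the connecting cocycle is the carry cocycle
`c_χ ⊗ a` with `a ↦ N_s ĩ` (`carryFun_smul_cycNorm`).

Consequence (with part I): `ker(res_T) = κ(A^G) ≅ A^G / N A^T`, e.g. the cyclic case of the
Brauer group, `Br(L/K) ≅ Kˣ / N_{L/K} Lˣ` (XIII §3–4).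

## References

* J.-P. Serre, *Corps locaux* (1968) / *Local Fields* (1979), VII §6 Prop. 5, VIII §4,
  XIII §3. [SerreLocalFields1979]
* S. S. Shatz, *Profinite groups, arithmetic, and geometry* (1972), II §4 (24)–(25). [Shatz1972]
-/

noncomputable section

open CategoryTheory Limits Function

universe u

namespace Literature.NumberTheory.GaloisRepresentations

open _root_.TopRep _root_.ContRepresentation _root_.ContinuousCohomology

/-! ### Restriction of classes to a subgroup, and naturality of `δ₁` -/

section Res

variable {k : Type*} [CommRing k] [TopologicalSpace k]
variable {G : Type u} [Group G] [TopologicalSpace G] [IsTopologicalGroup G]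
variable (T : Subgroup G)
variable {M : Type u} [AddCommGroup M] [Module k M] [TopologicalSpace M] [DiscreteTopology M]
  [ContinuousSMul k M]

/-- **The restriction `res : Hⁿ(G, M) → Hⁿ(T, M|_T)`** to a subgroup (Mathlib's
`ContinuousCohomology.map` along the inclusion). [cite: SerreGaloisCohomology1997, I §2.4] -/
abbrev resH (ρ : ContinuousRep G k M) (n : ℕ) :
    continuousCohomology n ρ.toTopRep ⟶ continuousCohomology n (ρ.restrict (subgroupIncl T)).toTopRep :=
  ContinuousCohomology.map (subgroupIncl T) (𝟙 ((ρ.restrict (subgroupIncl T)).toTopRep)) n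

/-- `res [φ] = [φ|_T]` in degree one. [folklore] -/
theorem resH_oneCocycleClass (ρ : ContinuousRep G k M) (φ : contOneCocycles ρ.toTopRep) :
    resH T ρ 1 (oneCocycleClass _ φ) =
      oneCocycleClass _ (contOneCocycles.pullback (subgroupIncl T)
        (𝟙 ((ρ.restrict (subgroupIncl T)).toTopRep)) φ) :=
  map_oneCocycleClass _ _ _ φ

/-- `res [c] = [c|_{T×T}]` in degree two. [folklore] -/
theorem resH_twoCocycleClass [LocallyCompactSpace G] [LocallyCompactSpace T] (ρ : ContinuousRep G k M)
    (c : contTwoCocycles ρ.toTopRep) :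
    resH T ρ 2 (twoCocycleClass _ c) =
      twoCocycleClass _ (contTwoCocycles.pullback (subgroupIncl T)
        (𝟙 ((ρ.restrict (subgroupIncl T)).toTopRep)) c) :=
  map_twoCocycleClass _ _ _ c

variable {M₂ : Type u} [AddCommGroup M₂] [Module k M₂] [TopologicalSpace M₂] [DiscreteTopology M₂]
  [ContinuousSMul k M₂]
variable {M₃ : Type u} [AddCommGroup M₃] [Module k M₃] [TopologicalSpace M₃] [DiscreteTopology M₃]
  [ContinuousSMul k M₃]
variable {ρ₁ : ContinuousRep G k M} {ρ₂ : ContinuousRep G k M₂} {ρ₃ : ContinuousRep G k M₃}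
variable {f : ρ₁.toTopRep ⟶ ρ₂.toTopRep} {g : ρ₂.toTopRep ⟶ ρ₃.toTopRep}

/-- **Naturality of `δ₁` under restriction to a subgroup**: `res (δ₁ x) = δ₁ (res x)` for the
restricted short exact sequence (on cocycles: the restriction of a lift is a lift of the
restriction, and `f⁻¹` is unchanged). [cite: SerreGaloisCohomology1997, I §2.4] -/
theorem IsSES.res_δ₁ [LocallyCompactSpace G] [LocallyCompactSpace T] (h : IsSES f g)
    (x : continuousCohomology 1 ρ₃.toTopRep) :
    resH T ρ₁ 2 (h.δ₁ x) = (h.res T).δ₁ (resH T ρ₃ 1 x) := by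
  obtain ⟨φ, rfl⟩ := oneCocycleClass_surjective _ x
  rw [IsSES.δ₁_oneCocycleClass_eq_δ₁Aux, IsSES.δ₁Aux, resH_twoCocycleClass, resH_oneCocycleClass]
  -- the restricted lift
  let φt : C(T, M₂) := (h.liftCocycle φ).comp ⟨((↑) : T → G), continuous_subtype_val⟩
  have hφt : ∀ σ τ : T, (resModHom T g).hom (φt (σ * τ)) =
      (resModHom T g).hom (φt σ) + (ρ₃.restrict (subgroupIncl T)) σ ((resModHom T g).hom (φt τ)) :=
    fun σ τ => h.liftCocycle_isLift φ σ τ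
  have e : contOneCocycles.pullback (subgroupIncl T) (𝟙 ((ρ₃.restrict (subgroupIncl T)).toTopRep)) φ =
      IsSES.pushCocycle φt hφt :=
    Subtype.ext (ContinuousMap.ext fun σ => (h.g_liftCocycle_apply φ σ).symm)
  rw [e, IsSES.δ₁_oneCocycleClass]
  refine congrArg _ (Subtype.ext (ContinuousMap.ext fun q => ?_))
  obtain ⟨σ, τ⟩ := q
  apply (h.res T).injective
  rw [(h.res T).f_connectingCocycle_apply]
  change f.hom ((h.connectingCocycle (h.liftCocycle φ) (h.liftCocycle_isLift φ)).1 ((σ : G), (τ : G))) =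
    ρ₂ (σ : G) (h.liftCocycle φ τ) - h.liftCocycle φ ((σ : G) * τ) + h.liftCocycle φ σ
  exact h.f_connectingCocycle_apply _ _ _ _

end Res

/-! ### Equivariant maps and power sums -/

section MapPowSum

variable {G : Type u} [Group G] [TopologicalSpace G]
variable {M : Type u} [AddCommGroup M] [TopologicalSpace M] [DiscreteTopology M]
variable {M' : Type u} [AddCommGroup M'] [TopologicalSpace M'] [DiscreteTopology M']
variable {ρ : ContinuousRep G ℤ M} {ρ' : ContinuousRep G ℤ M'}

/-- Equivariant additive maps commute with power sums. [folklore] -/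
theorem hom_powSum (φ : ρ.toTopRep ⟶ ρ'.toTopRep) (s : G) (i : ℕ) (x : M) :
    φ.hom (ρ.powSum s i x) = ρ'.powSum s i (φ.hom x) := by
  simp only [ContinuousRep.powSum, map_sum]
  exact Finset.sum_congr rfl fun _ _ => ContinuousRep.hom_comm_apply φ _ _

/-- Crossed homomorphisms on powers: `ψ(sⁱ) = Σ_{k<i} s^k ψ(s)`. [folklore] -/
theorem contOneCocycles.apply_pow (ψ : contOneCocycles ρ.toTopRep) (s : G) (i : ℕ) :
    ψ.1 (s ^ i) = ρ.powSum s i (ψ.1 s) := by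
  induction i with
  | zero => rw [pow_zero, contOneCocycles.apply_one, ContinuousRep.powSum_zero]
  | succ i ih =>
    rw [pow_succ, ψ.2, ih, ContinuousRep.powSum_succ]
    rfl

end MapPowSum

/-! ### Every class killed by `res_T` is a `κ(a)` -/

section Surjective

variable {G : Type u} [Group G] [TopologicalSpace G] [IsTopologicalGroup G] [CompactSpace G]
  [T2Space G] [TotallyDisconnectedSpace G]
variable {d : ℕ} [NeZero d] (χ : CyclicCharacter G d)
variable {A : Type u} [AddCommGroup A] [TopologicalSpace A] [DiscreteTopology A]
variable (ρ : ContinuousRep G ℤ A)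

/-- **Every `z ∈ H²(G, A)` with `res_T z = 0` is a cyclic class `κ(a)`, `a ∈ A^G`**, for a cyclic
layer `χ : G → ℤ/d` (`d > 1`) of a profinite group with kernel `T` and a discrete module `A` with
`H¹(T, A) = 0` (e.g. `A = L̄ˣ`).  With `CyclicLayerCarry.lean`:
`ker(res : H²(G, A) → H²(T, A)) = κ(A^G) ≅ A^G / N_s A^T`.
[cite: SerreLocalFields1979, VII §6 Prop. 5 and VIII §4] -/
theorem exists_cyclicClass_eq_of_res_eq_zero [Fact (1 < d)]
    (hT : Subsingleton (continuousCohomology 1 ((ρ.restrict (subgroupIncl χ.ker)).toTopRep)))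
    (z : continuousCohomology 2 ρ.toTopRep) (hz : resH χ.ker ρ 2 z = 0) :
    ∃ a : ρ.toTopRep.ρ.invariants, cyclicClass χ ρ a = z := by
  haveI : CompactSpace χ.ker := isCompact_iff_compactSpace.mp χ.isClosed_ker.isCompact
  haveI : IsClosed (χ.ker : Set G) := χ.isClosed_ker
  obtain ⟨s, hs⟩ := χ.exists_map_eq_one
  -- the dimension shift `0 → A → I = C(G, A) → Q → 0`
  have h : IsSES ρ.coindι ρ.coindπ := isSES_coind ρ
  -- Step 1: `z = δ₁ [ψ]`
  have hz0 : cohomologyMap ρ.coindι 2 z = 0 := by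
    haveI := subsingleton_coind ρ 1
    exact Subsingleton.elim _ _
  obtain ⟨q, rfl⟩ := h.exists_δ₁_eq_of_map_two_eq_zero z hz0
  obtain ⟨ψ, rfl⟩ := oneCocycleClass_surjective _ q
  -- Step 2: `res_T [ψ] = 0`
  have hres : resH χ.ker ρ.coindQuot 1 (oneCocycleClass _ ψ) = 0 := by
    have h1 : (h.res χ.ker).δ₁ (resH χ.ker ρ.coindQuot 1 (oneCocycleClass _ ψ)) = 0 := by
      rw [← h.res_δ₁ χ.ker, hz]
    obtain ⟨y, hy⟩ := (h.res χ.ker).exists_map_one_eq_of_δ₁_eq_zero _ h1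
    haveI := subsingleton_coind_restrict χ.ker ρ 0
    rw [← hy, Subsingleton.elim y 0, map_zero]
  -- Step 3: normalise `ψ|_T = 0`
  rw [resH_oneCocycleClass, oneCocycleClass_eq_zero_iff] at hres
  obtain ⟨v, hv⟩ := hres
  have hv' : ∀ t : χ.ker, ψ.1 t = ρ.coindQuot (t : G) v - v := fun t => hv t
  let pv : contOneCocycles ρ.coindQuot.toTopRep :=
    ⟨⟨fun σ => ρ.coindQuot σ v - v, (ρ.coindQuot.continuous_apply_left v).sub continuous_const⟩,
      fun σ τ => by
        change ρ.coindQuot (σ * τ) v - v = ρ.coindQuot σ v - v + ρ.coindQuot σ (ρ.coindQuot τ v - v)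
        rw [map_mul, Module.End.mul_apply, map_sub]
        abel⟩
  have hpv : oneCocycleClass _ pv = 0 := (oneCocycleClass_eq_zero_iff _ pv).2 ⟨v, fun _ => rfl⟩
  let ψ' : contOneCocycles ρ.coindQuot.toTopRep := ψ - pv
  have hψ'eq : oneCocycleClass _ ψ = oneCocycleClass _ ψ' := by
    rw [oneCocycleClass_sub, hpv, sub_zero]
  have hψ'v : ∀ σ, ψ'.1 σ = ψ.1 σ - (ρ.coindQuot σ v - v) := fun _ => rfl
  have hψ'T : ∀ t ∈ χ.ker, ψ'.1 t = 0 := fun t ht => by rw [hψ'v, hv' ⟨t, ht⟩, sub_self]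
  -- Step 4: `ψ'` is constant on cosets of `T` with values in `Q^T`
  have hR : ∀ σ, ∀ t ∈ χ.ker, ψ'.1 (σ * t) = ψ'.1 σ := fun σ t ht => by
    rw [ψ'.2 σ t, hψ'T t ht, map_zero, add_zero]
  have hTv : ∀ σ, ∀ t ∈ χ.ker, ρ.coindQuot t (ψ'.1 σ) = ψ'.1 σ := fun σ t ht => by
    have h1 := ψ'.2 t σ
    rw [hψ'T t ht, zero_add] at h1
    have hc : σ⁻¹ * t * σ ∈ χ.ker := by
      have := χ.normal_ker.conj_mem t ht σ⁻¹
      rwa [inv_inv] at this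
    rw [show t * σ = σ * (σ⁻¹ * t * σ) by group, hR σ _ hc] at h1
    exact h1.symm
  -- Step 5: `w = ψ'(s) ∈ Q^T`, `ψ'(sⁱ) = Σ_{k<i} s^k w`, `N_s w = 0`
  set w := ψ'.1 s with hw
  have hwT : ∀ t ∈ χ.ker, ρ.coindQuot t w = w := fun t ht => hTv s t ht
  have hpow : ∀ i, ψ'.1 (s ^ i) = ρ.coindQuot.powSum s i w := fun i => contOneCocycles.apply_pow ψ' s i
  have hσ : ∀ σ, ψ'.1 σ = ρ.coindQuot.powSum s (χ σ).val w := fun σ => by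
    rw [← hpow]
    conv_lhs => rw [← mul_inv_cancel_left (s ^ (χ σ).val) σ]
    exact hR _ _ (χ.pow_val_inv_mul_mem_ker hs σ)
  have hNw : ρ.coindQuot.cycNorm s d w = 0 := by
    rw [ContinuousRep.cycNorm, ← hpow, hψ'T _ (χ.pow_mem_ker hs)]
  -- Step 6: lift `w` to a `T`-invariant `ĩ ∈ C(G, A)` (`H¹(T, A) = 0`)
  obtain ⟨it, hit, hitw⟩ := (isSES_coind_restrict χ.ker ρ).exists_invariant_lift
    (subsingleton_coind_restrict χ.ker ρ 0) hT w ((mem_invariants _).2 fun t => hwT t t.2)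
  have hitT : ∀ t ∈ χ.ker, ρ.coind t it = it := fun t ht => (mem_invariants _).1 hit ⟨t, ht⟩
  have hitw' : ρ.coindπ.hom it = w := hitw
  -- Step 7: the lift `Ψ(σ) = Σ_{k<χ̃σ} s^k ĩ` of `ψ'` and its connecting cocycle
  let Ψ : C(G, C(G, A)) := ⟨fun σ => ρ.coind.powSum s (χ σ).val it,
    (continuous_of_discreteTopology (f := fun x : ZMod d => ρ.coind.powSum s x.val it)).comp
      χ.continuous⟩
  have hΨ : ∀ σ, ρ.coindπ.hom (Ψ σ) = ψ'.1 σ := fun σ =>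
    (hom_powSum ρ.coindπ s (χ σ).val it).trans
      ((congrArg (fun x => ρ.coindQuot.powSum s (χ σ).val x) hitw').trans (hσ σ).symm)
  have hΨlift : ∀ σ τ, ρ.coindπ.hom (Ψ (σ * τ)) =
      ρ.coindπ.hom (Ψ σ) + ρ.coindQuot σ (ρ.coindπ.hom (Ψ τ)) := fun σ τ => by
    rw [hΨ, hΨ, hΨ]; exact ψ'.2 σ τ
  have hpush : IsSES.pushCocycle Ψ hΨlift = ψ' :=
    Subtype.ext (ContinuousMap.ext fun σ => hΨ σ)
  -- the element `a` with `ι a = N_s ĩ`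
  have hNit : ρ.coindπ.hom (ρ.coind.cycNorm s d it) = 0 :=
    (hom_powSum ρ.coindπ s d it).trans
      ((congrArg (fun x => ρ.coindQuot.powSum s d x) hitw').trans hNw)
  obtain ⟨a, ha⟩ := h.exact_mid _ hNit
  have hNitG : ∀ g : G, ρ.coind g (ρ.coind.cycNorm s d it) = ρ.coind.cycNorm s d it :=
    apply_cycNorm_eq χ ρ.coind hs hitT
  have hainv : a ∈ ρ.toTopRep.ρ.invariants := fun g => h.injective (by
    change ρ.coindι.hom (ρ g a) = ρ.coindι.hom a
    rw [ContinuousRep.hom_comm_apply ρ.coindι g a, ha]; exact hNitG g)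
  refine ⟨⟨a, hainv⟩, ?_⟩
  rw [hψ'eq, ← hpush, IsSES.δ₁_oneCocycleClass, cyclicClass_apply]
  refine congrArg _ (Subtype.ext (ContinuousMap.ext fun q => ?_))
  obtain ⟨σ, τ⟩ := q
  apply h.injective
  rw [h.f_connectingCocycle_apply, carryCocycle_apply]
  change ρ.coindι.hom (χ.carryFun σ τ • a) = _
  rw [map_zsmul, ha]
  exact carryFun_smul_cycNorm χ ρ.coind hs hitT σ τ

end Surjective

end Literature.NumberTheory.GaloisRepresentations

end
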